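import Mathlib
import HarnessLib

/-!
# The odd (half-turn) cell of `NS₂`: which centre channels are LOCAL — exact primitives for bilinear pairings
(Negative lane bookkeeping, supports `RungBlowupCofinal` / BC5 rung 2 «HalfTurn»; circuit seat g9; companion of
`StrainSectorCentreLaw.lean`)

MODEL, NOT NS.  In the odd cell `{α = B = 0}` of the degree-`2` angular Galerkin truncation (`u = T₁[β(r)] + P₂[A(r)]`,
`β : [0,∞) → ℝ³`, `A : [0,∞) → Sym₀(3)`; the half-turn cell of `Cruxes/RungBlowupCofinal/Lines/halfturn.lean` is the sub-cell
`β ∥ e₃`, `A` block-diagonal) the quadrupole coefficient obeys `𝓛₇(Aₜ − ν𝓛₇A) = S_A` with (AGL-RUNG2-STRUCTURE §1)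

  `S_A = [A·A] + [β·β] + [β·A]`,
  `[A·A] = −(216/7r) sym₀(AA′) − (78/7) sym₀(AA″) − (6/7) r sym₀(AA‴) − (72/7) sym₀(A′A′) − (12/7) r sym₀(A′A″)`,
  `[β·β] = −(2/r) sym₀(β ⊗ β′)`,   `[β·A] = (4/r) C(β,A′) + (2/3) C(β,A″) − (3/r) C(β′,A) − (1/3) C(β′,A′) − C(β″,A)`,

and the centre strain rate is `Ȧ(0) = 7νA″(0) − (1/5)∫₀^∞ r S_A dr` (`StrainSectorCentreLaw.integral_Ioi_r_mul_L7`).  The pairings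
`(X,Y) ↦ sym₀(XY)` (on symmetric matrices) and `(v,w) ↦ sym₀(v ⊗ w)` are SYMMETRIC bilinear; `C(v,M) = [v]ₓM − M[v]ₓ` is bilinear.
This file proves, for an ARBITRARY continuous bilinear pairing `B` (symmetric where stated) on normed spaces and `C³`/`C²`/`C¹` curves:

* `hasDerivWithinAt_selfStrainPrimitive` : `r·[A·A] = −d/dr sym₀[(75/7)A² + (66/7) r AA′ + (6/7) r² AA″ + (3/7) r² A′A′]` — an EXACT
  primitive for every symmetric `B` (so `−(1/5)∫₀^∞ r[A·A] = −(15/7) sym₀(A(0)²)`: LOCAL);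
* `hasDerivWithinAt_couettePrimitive` : `r·[β·β] = −d/dr sym₀(β ⊗ β)` (so `−(1/5)∫ = −(1/5) sym₀(β₀ ⊗ β₀)`: LOCAL);
* `hasDerivWithinAt_precessionPrimitive` : `r·[β·A] = d/dr[(10/3) C(β,A) + (2/3) r C(β,A′) − r C(β′,A)] − (16/3) C(β′,A)` — a primitive
  PLUS the remainder `−(16/3)C(β′,A)`, so `−(1/5)∫₀^∞ r[β·A] = (2/3) C(β₀,A₀) + (16/15)∫₀^∞ C(β′,A) dr`: the precession channel is the
  ONE irreducibly NON-LOCAL term of the odd-cell centre law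

  `Ȧ₀ = 7νA″(0) − (15/7) sym₀(A₀²) − (1/5) sym₀(β₀⊗β₀) + (2/3) C(β₀,A₀) + (16/15) ∫₀^∞ C(β′,A) dr`,  `β̇₀ = 5νβ″(0) + 3A₀β₀`

  (circuit g8 CENTRE-LAW-ODDCELL.md, engine test T4b; bc5w's `c₁ = 2/3`, `c₂ = 16/15`).  In the half-turn cell `C(β′,A) = b′·[ [e₃]ₓ, A ]`
  vanishes iff `A` is axisymmetric about `e₃`: the non-local term is exactly swirl-shear × non-axisymmetric strain.

Pure calculus about bilinear maps; nothing here asserts a Theses declaration.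
-/

namespace Summit.NavierStokesRegularity.RungBlowupCofinalOddCellCentre

open Set Filter Topology

variable {V W : Type*} [NormedAddCommGroup V] [NormedSpace ℝ V] [NormedAddCommGroup W] [NormedSpace ℝ W]

/-- **The self-straining channel is an exact primitive for every symmetric bilinear pairing.**  For a `C³` curve `A` in `V`
(`A′ = A1`, `A1′ = A2`, `A2′ = A3` at `r` within `D`) and a symmetric continuous bilinear `B : V × V → W`,
`d/dr [ (75/7) B(A,A) + (66/7) r B(A,A′) + (6/7) r² B(A,A″) + (3/7) r² B(A′,A′) ]
 = (216/7) B(A,A′) + (78/7) r B(A,A″) + (6/7) r² B(A,A‴) + (72/7) r B(A′,A′) + (12/7) r² B(A′,A″)` (`= −r·[A·A]`). -/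
theorem hasDerivWithinAt_selfStrainPrimitive (B : V →L[ℝ] V →L[ℝ] W) (hB : ∀ x y, B x y = B y x)
    {A A1 A2 A3 : ℝ → V} {D : Set ℝ} {r : ℝ}
    (h0 : HasDerivWithinAt A (A1 r) D r) (h1 : HasDerivWithinAt A1 (A2 r) D r) (h2 : HasDerivWithinAt A2 (A3 r) D r) :
    HasDerivWithinAt (fun x => (75 / 7 : ℝ) • B (A x) (A x) + (66 / 7 : ℝ) • (x • B (A x) (A1 x))
        + (6 / 7 : ℝ) • (x ^ 2 • B (A x) (A2 x)) + (3 / 7 : ℝ) • (x ^ 2 • B (A1 x) (A1 x)))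
      ((216 / 7 : ℝ) • B (A r) (A1 r) + ((78 / 7 : ℝ) * r) • B (A r) (A2 r) + ((6 / 7 : ℝ) * r ^ 2) • B (A r) (A3 r)
        + ((72 / 7 : ℝ) * r) • B (A1 r) (A1 r) + ((12 / 7 : ℝ) * r ^ 2) • B (A1 r) (A2 r)) D r := by
  have hx : HasDerivWithinAt (fun x : ℝ => x) 1 D r := hasDerivWithinAt_id r D
  have hx2 : HasDerivWithinAt (fun x : ℝ => x ^ 2) (2 * r) D r := by
    have := (hasDerivAt_pow 2 r).hasDerivWithinAt (s := D)
    refine this.congr_deriv ?_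
    norm_num
  have e00 := B.hasDerivWithinAt_of_bilinear h0 h0
  have e01 := B.hasDerivWithinAt_of_bilinear h0 h1
  have e02 := B.hasDerivWithinAt_of_bilinear h0 h2
  have e11 := B.hasDerivWithinAt_of_bilinear h1 h1
  have h := (((e00.const_smul (75 / 7 : ℝ)).add ((hx.smul e01).const_smul (66 / 7 : ℝ))).add
    ((hx2.smul e02).const_smul (6 / 7 : ℝ))).add ((hx2.smul e11).const_smul (3 / 7 : ℝ))
  refine h.congr_deriv ?_
  simp only [hB (A1 r) (A r), hB (A2 r) (A1 r), one_smul, smul_add, smul_smul]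
  module

/-- **The spherical-Couette channel is an exact primitive**: for a symmetric bilinear `B` and a `C¹` curve `β`,
`d/dr B(β,β) = 2 B(β,β′)` (`= −r·[β·β]` with `[β·β] = −(2/r) sym₀(β⊗β′)`). -/
theorem hasDerivWithinAt_couettePrimitive (B : V →L[ℝ] V →L[ℝ] W) (hB : ∀ x y, B x y = B y x)
    {β β1 : ℝ → V} {D : Set ℝ} {r : ℝ} (h0 : HasDerivWithinAt β (β1 r) D r) :
    HasDerivWithinAt (fun x => B (β x) (β x)) ((2 : ℝ) • B (β r) (β1 r)) D r := by
  have e := B.hasDerivWithinAt_of_bilinear h0 h0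
  refine e.congr_deriv ?_
  rw [hB (β1 r) (β r), two_smul]

variable {V₁ V₂ : Type*} [NormedAddCommGroup V₁] [NormedSpace ℝ V₁] [NormedAddCommGroup V₂] [NormedSpace ℝ V₂]

/-- **The precession channel is a primitive plus `−(16/3) C(β′,A)`.**  For ANY continuous bilinear `C : V₁ × V₂ → W`, a `C²`
curve `β` in `V₁` and a `C²` curve `A` in `V₂` (derivatives within `D` at `r`),
`d/dr [ (10/3) C(β,A) + (2/3) r C(β,A′) − r C(β′,A) ]
 = 4 C(β,A′) + (2/3) r C(β,A″) − 3 C(β′,A) − (1/3) r C(β′,A′) − r C(β″,A) + (16/3) C(β′,A)`,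
i.e. `r·[β·A] = (primitive)′ − (16/3) C(β′,A)`: after `−(1/5)∫₀^∞ r(·)`, the centre law keeps the boundary value
`(2/3) C(β(0),A(0))` AND the whole-profile term `(16/15)∫₀^∞ C(β′,A) dr`. -/
theorem hasDerivWithinAt_precessionPrimitive (C : V₁ →L[ℝ] V₂ →L[ℝ] W)
    {β β1 β2 : ℝ → V₁} {A A1 A2 : ℝ → V₂} {D : Set ℝ} {r : ℝ}
    (hb0 : HasDerivWithinAt β (β1 r) D r) (hb1 : HasDerivWithinAt β1 (β2 r) D r)
    (ha0 : HasDerivWithinAt A (A1 r) D r) (ha1 : HasDerivWithinAt A1 (A2 r) D r) :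
    HasDerivWithinAt (fun x => (10 / 3 : ℝ) • C (β x) (A x) + (2 / 3 : ℝ) • (x • C (β x) (A1 x)) - x • C (β1 x) (A x))
      ((4 : ℝ) • C (β r) (A1 r) + ((2 / 3 : ℝ) * r) • C (β r) (A2 r) - (3 : ℝ) • C (β1 r) (A r)
        - ((1 / 3 : ℝ) * r) • C (β1 r) (A1 r) - r • C (β2 r) (A r) + (16 / 3 : ℝ) • C (β1 r) (A r)) D r := by
  have hx : HasDerivWithinAt (fun x : ℝ => x) 1 D r := hasDerivWithinAt_id r D
  have e00 := C.hasDerivWithinAt_of_bilinear hb0 ha0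
  have e01 := C.hasDerivWithinAt_of_bilinear hb0 ha1
  have e10 := C.hasDerivWithinAt_of_bilinear hb1 ha0
  have h := ((e00.const_smul (10 / 3 : ℝ)).add ((hx.smul e01).const_smul (2 / 3 : ℝ))).sub (hx.smul e10)
  refine h.congr_deriv ?_
  simp only [one_smul, smul_add, smul_smul]
  module

/-- **Reading for the half-turn cell.**  With swirl `β = b(r) e₃` the precession pairing is `C(β′, A) = b′ · ([e₃]ₓ A − A [e₃]ₓ)`,
and for a block-diagonal symmetric trace-free strain `A = [[p, q, 0], [q, s, 0], [0, 0, −(p+s)]]` (the half-turn cell's shape)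
the commutator with the rotation generator `J = [e₃]ₓ = [[0,−1,0],[1,0,0],[0,0,0]]` is
`J A − A J = [[−2q, p − s, 0], [p − s, 2q, 0], [0, 0, 0]]`. -/
theorem rotGen_commutator_blockDiag (p q s : ℝ) {J A : Matrix (Fin 3) (Fin 3) ℝ}
    (hJ : J = !![0, -1, 0; 1, 0, 0; 0, 0, 0]) (hA : A = !![p, q, 0; q, s, 0; 0, 0, -(p + s)]) :
    J * A - A * J = !![-2 * q, p - s, 0; p - s, 2 * q, 0; 0, 0, 0] := by
  subst hJ hA
  ext i j
  fin_cases i <;> fin_cases j <;> simp <;> ring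

/-- **… and it vanishes iff the strain is axisymmetric about `e₃`** (`q = 0`, `p = s`): the irreducibly non-local term
`(16/15)∫₀^∞ C(β′,A) dr` of the odd-cell centre law is exactly swirl-shear × non-axisymmetric strain — absent in the m = 0
control sector (`StrainSectorCentreLaw`), present in the genuinely half-turn data. -/
theorem rotGen_commutator_eq_zero_iff (p q s : ℝ) {J A : Matrix (Fin 3) (Fin 3) ℝ}
    (hJ : J = !![0, -1, 0; 1, 0, 0; 0, 0, 0]) (hA : A = !![p, q, 0; q, s, 0; 0, 0, -(p + s)]) :
    J * A - A * J = 0 ↔ q = 0 ∧ p = s := by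
  rw [rotGen_commutator_blockDiag p q s hJ hA]
  constructor
  · intro h
    have h01 := congrArg (fun M : Matrix (Fin 3) (Fin 3) ℝ => M 0 1) h
    have h11 := congrArg (fun M : Matrix (Fin 3) (Fin 3) ℝ => M 1 1) h
    simp at h01 h11
    exact ⟨by linarith, by linarith⟩
  · rintro ⟨hq, hps⟩
    subst hq hps
    ext i j
    fin_cases i <;> fin_cases j <;> simp

end Summit.NavierStokesRegularity.RungBlowupCofinalOddCellCentre
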